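import Summits.ResolutionOfSingularities.ResolutionOfSingularities.Theorems.EquisingularLiftCampaignW45bEquisingularLiftNat
import Summits.ResolutionOfSingularities.ResolutionOfSingularities.Theorems.EquisingularLiftEquisingularLiftProjectiveAmbientFibre
import Summits.ResolutionOfSingularities.ResolutionOfSingularities.Theorems.EquisingularLiftEquisingularLiftProjectiveAmbientSmoothProper
import Summits.ResolutionOfSingularities.ResolutionOfSingularities.Theses.EquisingularLift
import HarnessLib

/-!
# [OURS · L1 W4.5(b)] EL♮ → EL: the ONE instantiation (director-resolution g3 RULING 2026-08-27T00:46:45Z, deliverable (1)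
# second half = the support item `EquisingularLiftOfNat` «EquisingularLiftNat → EquisingularLift» of EL-NATURAL.md §3/§4) —
# companion PROOF file of `Theorems/EquisingularLiftCampaignW45bEquisingularLiftNat.lean`; host route EquisingularLift,
# `--supports stmt-ResolutionOfSingularities-15660`

HONEST FRAMING. OURS (cell res-hironaka, crux chain w45b, slot W4.5(b); proved by res-L1-type-o1 on res-L1-w45b-plan-1's dossier
L/w45b/EL-NATURAL/, whose `SketchELnat.lean` states this theorem with a `sorry` as «prover task ≈ M»); NOT a statement of any
manuscript. PURE PLUMBING over the w45b toolkit, following the plan in `informal-EquisingularLiftOfNat.txt`: given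
`EquisingularLiftNatA` (the E1-free middle term; the item `EquisingularLiftNat` implies it by `equisingularLiftNatA_of_nat`),
instantiate its universally quantified graded map at `φ := ⟨MvPolynomial.map π, _⟩` with
`hφ' := ProjectiveAmbientFibre.irrelevant_le_map_gradedMap` (p160143) and `Y := range (ι ≫ Proj.map φ hφ')`; then the four
conjuncts EL (`Theses.EquisingularLift.EquisingularLift`, stmt-15660) asks of its existential ambient are THEOREMS about the
fixed data: `Smooth q ∧ IsProper q` (`stub_projectiveAmbientSmoothProper`, p159079), `Y ⊆ q⁻¹{closed point}` and
`V(Y)_red ≅ H` (the argument INSIDE `stub_projectiveAmbientFibre`, p160143: `ℙⁿ_k = ℙⁿ_O ×_O k` by `isPullback_projMap`, Liu 2002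
Prop. 3.1.9, so `Proj.map φ` is a closed immersion onto the special fibre; a closed immersion from the reduced `H` has kernel
the vanishing ideal sheaf of its range); and a predicate closed under ALL regular-centre steps over non-generic points of `Y`
is closed under the fewer steps EL♮ allows, so EL♮'s chain is an EL chain; irreducibility and regularity clauses verbatim.
AI review is weaker than expert review. No `sorry`; axioms standard.

* `equisingularLift_of_equisingularLiftNatA : (∀ p, EquisingularLiftNatA p) → EquisingularLift` — THE INSTANTIATION;
* `equisingularLift_of_equisingularLiftNat : (∀ p, EquisingularLiftNat p) → EquisingularLift` — the support item's statement
  (modulo the `Iff.rfl` bridge `(∀ p, Theorems.EquisingularLiftNat p) ↔ Theses.EquisingularLift.EquisingularLiftNat` once the route-repair seat has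
  added the route decl with the same text, EL-NATURAL.md §4);
* `equisingularLift_of_equisingularLiftNatSmooth` — the same from the `O`-smooth working strengthening.

References: companion module docstring; L/w45b/EL-NATURAL/ (res-L1-w45b-plan-1); Q. Liu, *Algebraic Geometry and Arithmetic
Curves* (2002), Prop. 3.1.9 / Ex. 3.1.10; route file Theses/EquisingularLift.lean (stmt-15660).
-/

set_option linter.dupNamespace false -- mandated namespace of this single-conjunct summit

noncomputable section

open CategoryTheory CategoryTheory.Limits AlgebraicGeometry TopologicalSpace
open MvPolynomial HomogeneousIdeal
open Summit.ResolutionOfSingularities.ResolutionOfSingularities.Cruxes.EquisingularLift.StrataSplit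
open Summit.ResolutionOfSingularities.ResolutionOfSingularities.Theses.EquisingularLift

namespace Summit.ResolutionOfSingularities.ResolutionOfSingularities.Theorems

/-- **EL♮ (A) ⇒ EL — THE INSTANTIATION** (the `sorry` of the planner's `SketchELnat.lean`, discharged): the fixed ambient
`ℙⁿ_O` with `Y := range (ι ≫ Proj.map (MvPolynomial.map π))` witnesses the existential ambient block of
`Theses.EquisingularLift.EquisingularLift`. [folklore] -/
theorem equisingularLift_of_equisingularLiftNatA (h : ∀ p : ℕ, EquisingularLiftNatA p) : EquisingularLift := by
  intro p hp k _ _ _ n H ι hι hH hloc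
  obtain ⟨O, i1, i2, i3, i4, π, hπ, h'⟩ := h p hp k n H ι hι hH hloc
  -- the gradings by degree (Mathlib abbrevs, not instances; the statement carries them as `letI`)
  letI := MvPolynomial.gradedAlgebra (σ := Fin (n + 1)) (R := O)
  letI := MvPolynomial.gradedAlgebra (σ := Fin (n + 1)) (R := k)
  -- the graded base-change map `O[x] → k[x]` and the comparison `g : ℙⁿ_k ⟶ ℙⁿ_O`
  let φ : homogeneousSubmodule (Fin (n + 1)) O →+*ᵍ homogeneousSubmodule (Fin (n + 1)) k :=
    ⟨MvPolynomial.map π, fun h ↦ h.map π⟩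
  have hφ : ∀ s, φ s = MvPolynomial.map π s := fun _ ↦ rfl
  have hφ' := ProjectiveAmbientFibre.irrelevant_le_map_gradedMap π φ hφ
  obtain ⟨P', σ, S', hchain, hirr, hreg⟩ := h' φ hφ' hφ _ rfl
  have hP := ProjectiveAmbientFibre.isPullback_projMap π φ hφ hπ hφ'
  set q : Proj (homogeneousSubmodule (Fin (n + 1)) O) ⟶ Spec (.of O) :=
    Proj.toSpecZero (homogeneousSubmodule (Fin (n + 1)) O) ≫
      Spec.map (CommRingCat.ofHom (algebraMap O (homogeneousSubmodule (Fin (n + 1)) O 0))) with hq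
  set g : Proj (homogeneousSubmodule (Fin (n + 1)) k) ⟶ Proj (homogeneousSubmodule (Fin (n + 1)) O) :=
    Proj.map φ hφ' with hg
  -- `g` is a closed immersion onto the special fibre
  haveI : IsClosedImmersion (Spec.map (CommRingCat.ofHom π)) := IsClosedImmersion.spec_of_surjective _ hπ
  haveI : IsClosedImmersion g := MorphismProperty.IsStableUnderBaseChange.of_isPullback hP.flip inferInstance
  have hpt : ∀ x : Spec (.of k), Spec.map (CommRingCat.ofHom π) x = IsLocalRing.closedPoint O := by
    intro x
    rw [Spec.map_apply]
    apply PrimeSpectrum.ext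
    rw [PrimeSpectrum.comap_asIdeal, CommRingCat.hom_ofHom, Ideal.eq_bot_of_prime x.asIdeal, ← RingHom.ker_eq_comap_bot]
    exact IsLocalRing.eq_maximalIdeal (RingHom.ker_isMaximal_of_surjective π hπ)
  have hgq : ∀ x, q (g x) = IsLocalRing.closedPoint O := fun x ↦
    (Scheme.Hom.comp_apply g q x).symm.trans
      ((congrArg (fun h : Proj (homogeneousSubmodule (Fin (n + 1)) k) ⟶ Spec (.of O) ↦ h x) hP.w).trans
        ((Scheme.Hom.comp_apply _ _ x).trans (hpt _)))
  -- the closed immersion `f = ι ≫ g : H ⟶ ℙⁿ_O` and its range `Y`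
  haveI := hH
  let ι' : H ⟶ Proj (homogeneousSubmodule (Fin (n + 1)) k) := ι
  haveI : IsClosedImmersion ι' := hι
  let f : H ⟶ Proj (homogeneousSubmodule (Fin (n + 1)) O) := ι' ≫ g
  let Y : Closeds (Proj (homogeneousSubmodule (Fin (n + 1)) O)) := ⟨Set.range f, f.isClosedEmbedding.isClosed_range⟩
  have hsub : Set.range f ⊆ q ⁻¹' {IsLocalRing.closedPoint O} := by
    rintro _ ⟨x, rfl⟩
    show q (f x) = IsLocalRing.closedPoint O
    rw [show f x = g (ι' x) from Scheme.Hom.comp_apply _ _ x]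
    exact hgq (ι' x)
  obtain ⟨hsm, hprop⟩ := stub_projectiveAmbientSmoothProper O n
  refine ⟨O, i1, i2, i3, i4, Proj (homogeneousSubmodule (Fin (n + 1)) O), P', q, Y, σ, S', hsm, hprop, hsub, ?_, ?_,
    hirr, hreg⟩
  · -- `H` is reduced, so the kernel of the closed immersion `f` is the vanishing ideal sheaf of its range `Y`,
    -- which is also the kernel of `V(Y) ↪ ℙⁿ_O` (p160143's argument)
    have hYker : Scheme.IdealSheafData.vanishingIdeal Y = f.ker := by
      rw [← Scheme.IdealSheafData.map_bot, ← Scheme.nilradical_eq_bot, ← Scheme.IdealSheafData.vanishingIdeal_top,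
        Scheme.IdealSheafData.map_vanishingIdeal]
      congr 1
      ext1
      change Set.range f = closure (f '' Set.univ)
      rw [Set.image_univ, f.isClosedEmbedding.isClosed_range.closure_eq]
    have hker : (Scheme.IdealSheafData.vanishingIdeal Y).subschemeι.ker = f.ker := by
      rw [Scheme.IdealSheafData.ker_subschemeι, hYker]
    haveI := IsClosedImmersion.isIso_lift _ f hker
    exact ⟨(asIso (IsClosedImmersion.lift _ f hker.le)).symm⟩
  · -- EL♮'s chain (closure of `Q` under FEWER steps suffices) is an EL chain
    intro Q hQ0 hstep
    exact hchain Q hQ0 (fun X' X'' σ' Y' C τ hQ hbl hC hgen => hstep X' X'' σ' Y' C τ hQ hbl hC hgen)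

/-- **The support item `EquisingularLiftOfNat` as the ruling words it: EL♮ ⇒ EL** (through (A)). Once the route-repair seat
has added `Theses.EquisingularLift.EquisingularLiftNat` with the same text, `Iff.rfl` turns this into the closer of the route
item. [folklore] -/
theorem equisingularLift_of_equisingularLiftNat (h : ∀ p : ℕ, EquisingularLiftNat p) : EquisingularLift :=
  equisingularLift_of_equisingularLiftNatA fun p => equisingularLiftNatA_of_nat (h p)

/-- EL♮ with `O`-smooth centres ⇒ EL. [folklore] -/
theorem equisingularLift_of_equisingularLiftNatSmooth (h : ∀ p : ℕ, EquisingularLiftNatSmooth p) : EquisingularLift :=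
  equisingularLift_of_equisingularLiftNat fun p => equisingularLiftNat_of_smooth (h p)

/-! ## v2 APPEND (2026-08-27): the ∃g signature form `EquisingularLiftNatSig` (companion v2) — `Nat → Sig` and `Sig → EL` -/

/-- Pure plumbing: the canonical special-fibre embedding `Proj.map (MvPolynomial.map π)` is ONE admissible closed immersion
`g` over `Spec π` (closed immersion by base change along `isPullback_projMap`, p160143), and its composite with `ι` has closed
range, so the item form implies the signature form. [folklore] -/
theorem equisingularLiftNatSig_of_nat {p : ℕ} (h : EquisingularLiftNat p) : EquisingularLiftNatSig p := by
  intro hp n k _ _ _ H ι hι hH hloc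
  obtain ⟨O, i1, i2, i3, i4, π, hπ, h'⟩ := h hp k n H ι hι hH hloc
  letI := MvPolynomial.gradedAlgebra (σ := Fin (n + 1)) (R := O)
  letI := MvPolynomial.gradedAlgebra (σ := Fin (n + 1)) (R := k)
  let φ : homogeneousSubmodule (Fin (n + 1)) O →+*ᵍ homogeneousSubmodule (Fin (n + 1)) k :=
    ⟨MvPolynomial.map π, fun h ↦ h.map π⟩
  have hφ : ∀ s, φ s = MvPolynomial.map π s := fun _ ↦ rfl
  have hφ' := ProjectiveAmbientFibre.irrelevant_le_map_gradedMap π φ hφ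
  obtain ⟨P', σ, S', hchain, hirr, hreg⟩ := h' φ hφ' hφ _ rfl
  have hP := ProjectiveAmbientFibre.isPullback_projMap π φ hφ hπ hφ'
  set g : Proj (homogeneousSubmodule (Fin (n + 1)) k) ⟶ Proj (homogeneousSubmodule (Fin (n + 1)) O) :=
    Proj.map φ hφ' with hg
  haveI : IsClosedImmersion (Spec.map (CommRingCat.ofHom π)) := IsClosedImmersion.spec_of_surjective _ hπ
  haveI hgc : IsClosedImmersion g := MorphismProperty.IsStableUnderBaseChange.of_isPullback hP.flip inferInstance
  haveI := hH
  let ι' : H ⟶ Proj (homogeneousSubmodule (Fin (n + 1)) k) := ι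
  haveI : IsClosedImmersion ι' := hι
  have hcl : closure (Set.range (ι ≫ g : H ⟶ Proj (homogeneousSubmodule (Fin (n + 1)) O))) =
      Set.range (ι ≫ g : H ⟶ Proj (homogeneousSubmodule (Fin (n + 1)) O)) :=
    (ι' ≫ g).isClosedEmbedding.isClosed_range.closure_eq
  refine ⟨O, i1, i2, i3, i4, π, hπ, g, hgc, hP.w, P', σ, S', ?_, hirr, hreg⟩
  rw [hcl]
  exact hchain

/-- **EL♮ (signature form) ⇒ EL**: for ANY closed immersion `g : ℙⁿ_k ⟶ ℙⁿ_O` over `Spec π`, `Y := closure (range (ι ≫ g))`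
(`= range`, closed) lies in the special fibre (`g ≫ q` factors through `Spec π`, which hits the closed point of `O`),
`V(Y)_red ≅ H` (closed immersion from the reduced `H`: kernel = vanishing ideal sheaf of the range), `ℙⁿ_O` is smooth and
proper (p159079), and E1-chains are chains. [folklore] -/
theorem equisingularLift_of_equisingularLiftNatSig (h : ∀ p : ℕ, EquisingularLiftNatSig p) : EquisingularLift := by
  intro p hp k _ _ _ n H ι hι hH hloc
  obtain ⟨O, i1, i2, i3, i4, π, hπ, g, hg, hw, P', σ, S', hchain, hirr, hreg⟩ := h p hp n k H ι hι hH hloc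
  letI := MvPolynomial.gradedAlgebra (σ := Fin (n + 1)) (R := O)
  letI := MvPolynomial.gradedAlgebra (σ := Fin (n + 1)) (R := k)
  haveI := hH
  let ι' : H ⟶ Proj (homogeneousSubmodule (Fin (n + 1)) k) := ι
  haveI : IsClosedImmersion ι' := hι
  let g' : Proj (homogeneousSubmodule (Fin (n + 1)) k) ⟶ Proj (homogeneousSubmodule (Fin (n + 1)) O) := g
  haveI : IsClosedImmersion g' := hg
  set q : Proj (homogeneousSubmodule (Fin (n + 1)) O) ⟶ Spec (.of O) :=
    Proj.toSpecZero (homogeneousSubmodule (Fin (n + 1)) O) ≫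
      Spec.map (CommRingCat.ofHom (algebraMap O (homogeneousSubmodule (Fin (n + 1)) O 0))) with hq
  let f : H ⟶ Proj (homogeneousSubmodule (Fin (n + 1)) O) := ι' ≫ g'
  have hcl : closure (Set.range f) = Set.range f := f.isClosedEmbedding.isClosed_range.closure_eq
  have hpt : ∀ x : Spec (.of k), Spec.map (CommRingCat.ofHom π) x = IsLocalRing.closedPoint O := by
    intro x
    rw [Spec.map_apply]
    apply PrimeSpectrum.ext
    rw [PrimeSpectrum.comap_asIdeal, CommRingCat.hom_ofHom, Ideal.eq_bot_of_prime x.asIdeal, ← RingHom.ker_eq_comap_bot]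
    exact IsLocalRing.eq_maximalIdeal (RingHom.ker_isMaximal_of_surjective π hπ)
  have hgq : ∀ x, q (g' x) = IsLocalRing.closedPoint O := fun x ↦
    (Scheme.Hom.comp_apply g q x).symm.trans
      ((congrArg (fun h : (Literature.AlgebraicGeometry.Motives.projectiveSpace n k).left ⟶ Spec (.of O) ↦ h x) hw).trans
        ((Scheme.Hom.comp_apply _ _ x).trans (hpt _)))
  let Y : Closeds (Proj (homogeneousSubmodule (Fin (n + 1)) O)) := ⟨closure (Set.range f), isClosed_closure⟩
  have hsub : (Y : Set (Proj (homogeneousSubmodule (Fin (n + 1)) O))) ⊆ q ⁻¹' {IsLocalRing.closedPoint O} := by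
    show closure (Set.range f) ⊆ _
    rw [hcl]
    rintro _ ⟨x, rfl⟩
    show q (f x) = IsLocalRing.closedPoint O
    rw [show f x = g' (ι' x) from Scheme.Hom.comp_apply _ _ x]
    exact hgq (ι' x)
  obtain ⟨hsm, hprop⟩ := stub_projectiveAmbientSmoothProper O n
  refine ⟨O, i1, i2, i3, i4, Proj (homogeneousSubmodule (Fin (n + 1)) O), P', q, Y, σ, S', hsm, hprop, hsub, ?_, ?_,
    hirr, hreg⟩
  · have hY : Y = ⟨Set.range f, f.isClosedEmbedding.isClosed_range⟩ := Closeds.ext hcl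
    rw [hY]
    have hYker : Scheme.IdealSheafData.vanishingIdeal
        (⟨Set.range f, f.isClosedEmbedding.isClosed_range⟩ : Closeds (Proj (homogeneousSubmodule (Fin (n + 1)) O))) =
          f.ker := by
      rw [← Scheme.IdealSheafData.map_bot, ← Scheme.nilradical_eq_bot, ← Scheme.IdealSheafData.vanishingIdeal_top,
        Scheme.IdealSheafData.map_vanishingIdeal]
      congr 1
      ext1
      change Set.range f = closure (f '' Set.univ)
      rw [Set.image_univ, f.isClosedEmbedding.isClosed_range.closure_eq]
    have hker : (Scheme.IdealSheafData.vanishingIdeal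
        (⟨Set.range f, f.isClosedEmbedding.isClosed_range⟩ : Closeds (Proj (homogeneousSubmodule (Fin (n + 1)) O)))).subschemeι.ker
          = f.ker := by
      rw [Scheme.IdealSheafData.ker_subschemeι, hYker]
    haveI := IsClosedImmersion.isIso_lift _ f hker
    exact ⟨(asIso (IsClosedImmersion.lift _ f hker.le)).symm⟩
  · intro Q hQ0 hstep
    exact hchain Q hQ0 (fun X' X'' σ' Y' C τ hQ hbl hC hgen _ => hstep X' X'' σ' Y' C τ hQ hbl hC hgen)

end Summit.ResolutionOfSingularities.ResolutionOfSingularities.Theorems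

end
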